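import Literature.Geometry.Riemannian.CurvatureOperator
import Literature.Geometry.Riemannian.HamiltonPICClassification
import HarnessLib

/-!
# Hamilton 1986: compact 4-manifolds with positive curvature operator are `S⁴` or `ℝℙ⁴`
(topic `Geometry/Riemannian`)

Node RF7 of the decomposition of `Literature.Geometry.Riemannian.hamilton_chen_tang_zhu` (`HamiltonPICProofs.lean`),
in the printed generality now that the tree has real projective spaces
(`Literature.Topology.FourManifolds.IsRealProjectiveSpace`, `Literature/Topology/FourManifolds/RealProjectiveSpace.lean`):

> **Theorem 1.1 (Hamilton, J. Differential Geom. 24 (1986), p. 153).** A compact four-manifold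
> with a positive curvature operator is diffeomorphic to the sphere `S⁴` or the real projective
> space `RP⁴`.

* NAMED FACT `hamilton_positiveCurvatureOperator_classification_four`: a closed (compact,
  Hausdorff, second countable, `C^∞`, on `ℝ⁴`) **connected** 4-manifold carrying a `C^∞`
  Riemannian metric with positive curvature operator (`HasPositiveCurvatureOperator`,
  `CurvatureOperator.lean`: `Rm(φ, φ) > 0` for all 2-vectors `φ ≠ 0`) is diffeomorphic to the
  standard `S⁴ ⊂ ℝ⁵` or is a (standard) real projective 4-space (`Literature.IsRealProjectiveSpace 4 M`,
  i.e. `M ≅ 𝕊⁴/±1`; Hamilton's proof — convergence of the normalised Ricci flow to constant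
  positive curvature — yields the standard space form `S⁴/Γ`, `Γ ⊂ O(5)` acting freely, hence
  `Γ = 1` or `{±1}` in even dimension). Connectedness is the standing meaning of "manifold" in the
  source (a disjoint union of two round `S⁴`'s has positive curvature operator).
* PROVED from it: the **simply connected case**
  `hamilton_positiveCurvatureOperator_sphere_four_of_classification` — a closed simply connected
  4-manifold with a metric of positive curvature operator is diffeomorphic to `S⁴`, because
  `π₁(ℝℙ⁴) = ℤ₂ ≠ 1` (`IsRealProjectiveSpace.not_simplyConnectedSpace`) excludes the other
  alternative — stated here in full, with explicit binders. (Until 2026-08-15 this corollary was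
  also vended as a separate named fact `hamilton_positiveCurvatureOperator_sphere_four` in
  `CurvatureOperator.lean`, minted before the tree had `ℝℙ⁴`; being a three-line consequence of the
  printed theorem it is a duplicate entry of the same debt and is retired in favour of this theorem
  — one theorem of the source, one named fact; D-0026 review.) Also proved: such a manifold is
  one of Hamilton's model pieces `IsHamiltonPICPiece` of his 1997 Main Theorem 1.1
  (`HamiltonPICClassification.lean`)
  — the rôle of the theorem in the PIC programme: the compact components of positive curvature
  operator met by the flow with surgery (category (c) of the canonical neighbourhoods, Chen–Zhu
  2006, §5; Hamilton 1997, p. 3: "If one of these pieces is diffeomorphic to one of the standard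
  models, we throw it away. We can of course recognize such a piece as soon as its curvature
  operator becomes positive, by [4]") are discarded and re-attached by connected sum at the end.

## References

* R. S. Hamilton, *Four-manifolds with positive curvature operator*, J. Differential Geom. 24
  (1986) 153–179, Thm. 1.1 (p. 153). [Hamilton1986]
* R. S. Hamilton, *Four-manifolds with positive isotropic curvature*, Comm. Anal. Geom. 5 (1997),
  p. 3. [Hamilton1997]
* B.-L. Chen, X.-P. Zhu, J. Differential Geom. 74 (2006), §1 p. 2, §4 p. 18, §5 p. 27
  (arXiv:math/0504478). [ChenZhu2006]
-/

noncomputable section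

open Set
open scoped Manifold ContDiff

namespace Literature.Geometry.Riemannian

open Lorentzian

/-- Local notation: the standard `4`-sphere. -/
local notation "𝕊⁴" => (Metric.sphere (0 : EuclideanSpace ℝ (Fin 5)) 1)

/-- NAMED FACT (**Hamilton 1986, Thm. 1.1**, J. Differential Geom. 24, p. 153: "A compact
four-manifold with a positive curvature operator is diffeomorphic to the sphere `S⁴` or the real
projective space `RP⁴`"; proof: the normalised Ricci flow converges to a metric of constant
positive sectional curvature, §§2–10 of the paper). **Vended form**: `M : Type` a compact,
Hausdorff, second countable, connected `C^∞` 4-manifold on `ℝ⁴` carrying a `C^∞` Riemannian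
metric with positive curvature operator (`HasPositiveCurvatureOperator`, for the Levi-Civita
connection(s) of `g`); conclusion: `M` is diffeomorphic to the standard `S⁴`, or `M` is a real
projective 4-space in the sense of `Literature.IsRealProjectiveSpace 4 M` (a `C^∞` local diffeomorphism
`𝕊⁴ → M` identifying exactly antipodal points, i.e. `M ≅ 𝕊⁴/±1`, the standard `RP⁴`). The
simply connected case (`M ≅ S⁴`) is the corollary
`hamilton_positiveCurvatureOperator_sphere_four_of_classification` proved below. Users take
`(h : hamilton_positiveCurvatureOperator_classification_four)`.
[cite: Hamilton1986, §1, Thm. 1.1 (p. 153)] -/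
def hamilton_positiveCurvatureOperator_classification_four : Prop :=
  ∀ (M : Type) [TopologicalSpace M] [T2Space M] [SecondCountableTopology M] [CompactSpace M]
    [ConnectedSpace M] [ChartedSpace (EuclideanSpace ℝ (Fin 4)) M] [IsManifold (𝓡 4) ∞ M],
    (∃ g : PseudoRiemannianMetric (𝓡 4) ∞ (EuclideanSpace ℝ (Fin 4)) (TangentSpace (𝓡 4) : M → Type _),
        g.IsRiemannian ∧ g.HasPositiveCurvatureOperator) →
      Nonempty (M ≃ₘ⟮𝓡 4, 𝓡 4⟯ 𝕊⁴) ∨ Literature.Topology.FourManifolds.IsRealProjectiveSpace 4 M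

/-- **Hamilton 1986, Thm. 1.1 — the simply connected case, from the classification**: a closed
(compact, Hausdorff, second countable) simply connected smooth 4-manifold `M` carrying a `C^∞`
Riemannian metric with positive curvature operator (`HasPositiveCurvatureOperator`: `Rm(φ, φ) > 0`
for all 2-vectors `φ ≠ 0`, for the Levi-Civita connection) is diffeomorphic to the standard
sphere `S⁴ ⊂ ℝ⁵`. Of the two alternatives of the printed theorem ("diffeomorphic to the sphere
`S⁴` or the real projective space `RP⁴`", p. 153) the second is excluded by `π₁(RP⁴) = ℤ₂ ≠ 1`
(`IsRealProjectiveSpace.not_simplyConnectedSpace`, Hatcher Ex. 1.43), so for simply connected `M`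
(path connected, hence connected) only `S⁴` remains, given
`hamilton_positiveCurvatureOperator_classification_four`. This is the case met in Hamilton's 1997
surgery programme for `π₁ = 1` (the discarded compact components of positive curvature operator;
Hamilton 1997, p. 3, "[4]"; Chen–Zhu 2006, p. 2, "[Ha2]"). Formerly also vended as a separate named
fact `hamilton_positiveCurvatureOperator_sphere_four` (`CurvatureOperator.lean`), which is retired in
favour of this theorem: same hypotheses, same conclusion (definitionally), explicit binders.
[cite: Hamilton1986, §1, Thm. 1.1 (p. 153)] -/
theorem hamilton_positiveCurvatureOperator_sphere_four_of_classification
    (h : hamilton_positiveCurvatureOperator_classification_four)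
    (M : Type) [TopologicalSpace M] [T2Space M] [SecondCountableTopology M] [CompactSpace M]
    [ChartedSpace (EuclideanSpace ℝ (Fin 4)) M] [IsManifold (𝓡 4) ∞ M] [SimplyConnectedSpace M]
    (hg : ∃ g : PseudoRiemannianMetric (𝓡 4) ∞ (EuclideanSpace ℝ (Fin 4)) (TangentSpace (𝓡 4) : M → Type _),
        g.IsRiemannian ∧ g.HasPositiveCurvatureOperator) :
    Nonempty (M ≃ₘ⟮𝓡 4, 𝓡 4⟯ 𝕊⁴) := by
  rcases h M hg with h₁ | h₂
  · exact h₁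
  · exact absurd ‹SimplyConnectedSpace M› (h₂.not_simplyConnectedSpace (by norm_num))

/-- **A compact connected 4-manifold of positive curvature operator is one of Hamilton's model
pieces** (`S⁴` or `RP⁴`) of the Main Theorem 1.1 of Hamilton 1997 (`IsHamiltonPICPiece`,
`HamiltonPICClassification.lean`) — the use of the 1986 theorem in the PIC programme (Hamilton
1997, p. 3: "We can of course recognize such a piece [diffeomorphic to one of the standard
models] as soon as its curvature operator becomes positive, by [4]"; Chen–Zhu 2006, §5, p. 27:
"throw away all the compact components … with positive curvature operator"). From
`hamilton_positiveCurvatureOperator_classification_four`.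
[cite: Hamilton1997, §1, p. 3] [cite: Hamilton1986, §1, Thm. 1.1 (p. 153)] -/
theorem isHamiltonPICPiece_of_hasPositiveCurvatureOperator
    (h : hamilton_positiveCurvatureOperator_classification_four)
    (M : Type) [TopologicalSpace M] [T2Space M] [SecondCountableTopology M] [CompactSpace M]
    [ConnectedSpace M] [ChartedSpace (EuclideanSpace ℝ (Fin 4)) M] [IsManifold (𝓡 4) ∞ M]
    (g : PseudoRiemannianMetric (𝓡 4) ∞ (EuclideanSpace ℝ (Fin 4)) (TangentSpace (𝓡 4) : M → Type _))
    (hg : g.IsRiemannian) (hpco : g.HasPositiveCurvatureOperator) : IsHamiltonPICPiece M := by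
  rcases h M ⟨g, hg, hpco⟩ with h₁ | h₂
  · exact IsHamiltonPICPiece.of_nonempty_diffeomorph_sphere h₁
  · exact IsHamiltonPICPiece.of_isRealProjectiveSpace h₂

/-- Consequently such a manifold lies in the closure of Hamilton's pieces under connected sums
(as a single summand), the form of the conclusion of `hamilton_pic_classification_four`.
[cite: Hamilton1997, Thm. 1.1 (p. 2)] -/
theorem isConnectedSumOf_isHamiltonPICPiece_of_hasPositiveCurvatureOperator
    (h : hamilton_positiveCurvatureOperator_classification_four)
    (M : Type) [TopologicalSpace M] [T2Space M] [SecondCountableTopology M] [CompactSpace M]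
    [ConnectedSpace M] [ChartedSpace (EuclideanSpace ℝ (Fin 4)) M] [IsManifold (𝓡 4) ∞ M]
    (g : PseudoRiemannianMetric (𝓡 4) ∞ (EuclideanSpace ℝ (Fin 4)) (TangentSpace (𝓡 4) : M → Type _))
    (hg : g.IsRiemannian) (hpco : g.HasPositiveCurvatureOperator) :
    Literature.Topology.FourManifolds.IsConnectedSumOf 4 IsHamiltonPICPiece M :=
  .piece (isHamiltonPICPiece_of_hasPositiveCurvatureOperator h M g hg hpco)

end Literature.Geometry.Riemannian

end
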